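import Literature.AnabelianGeometry.SemiGraphs.PSCTwoComponentOriginRows
import Literature.AnabelianGeometry.SemiGraphs.PSCOriginVertexGrowth
import Literature.AnabelianGeometry.SemiGraphs.PSCSmoothProperShape
import Literature.AnabelianGeometry.SemiGraphs.PSCSmoothProperOrigin
import HarnessLib

/-!
# The two-component origin: the cusp-indexed rows F-0458 / F-1931 hold (no cusps) and covering-closure F-3808 fails

Mochizuki, *A combinatorial version of the Grothendieck conjecture* [CombGC], Tohoku Math. J. **59**
(2007): Thm. 1.6 (i) p. 13 ("`α` is numerically cuspidal if and only if it is group-theoretically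
cuspidal"), Def. 1.1 (ii) p. 6 (finite étale coverings of a semi-graph of anabelioids of PSC-type are of
PSC-type), and the replacement text [IUTchI] Rmk. 1.2.3 (iv) pp. 41–42 (cuspidal part) of Rmk. 1.4.3.
[cite: MochizukiCombGC2007, Thm 1.6(i) p.13] [cite: MochizukiCombGC2007, Def 1.1(ii) p.6]
[cite: Mochizuki2012, IUTchI Rmk 1.2.3(iv) pp.41-42]

PROOF-ONLY file (abc-iut cell, layer L3, L-F sub-cell [SemiAnbd]+[CombGC] pack C, the L3 lead's row
«F-0458 / F-0466 / F-2830: instance-or-vacuity at Ω_scg and the two-component origins», seat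
abc-iut-w5-d174 gen 5).  At abc-iut-w4-d052's two-component origin `Ω_tc`
(`exists_twoComponentOrigin_rows`: membership predicate exposed as an `↔`; data on profinite groups, NO
CUSPS, two vertices `v₀ ≠ v₁`, one node; inhabited for every nonempty set of primes and all genera
`g₁, g₂ ≥ 1`), this file adds three rows at the SAME origin:

* F-0458 `NumericallyCuspidalIffHolds Ω_tc` — VACUITY-BY-SHAPE instance: with no cusps on either side
  both "numerically cuspidal" (`r = 0` at every covering) and "group-theoretically cuspidal" (no cuspidal
  subgroups) hold for every `α` (abc-iut-L3-t4's `numericallyCuspidalIff_of_isEmpty`), packaged as the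
  origin-level `numericallyCuspidalIffHolds_of_isEmpty_cusps`;
* F-1931 `CuspidalEdgeLikeCharacterizationHolds Ω_tc` — likewise (`cuspidalEdgeLikeCharacterization_of_isEmpty`),
  packaged as `cuspidalEdgeLikeCharacterizationHolds_of_isEmpty_cusps`;
* **`¬ RestrictBDOfPSCTypeHolds Ω_tc`** (F-3808, the repaired Def. 1.1 (ii) covering-closure) — the
  NOT-exported remark of `PSCTwoComponentOriginRows.lean` made a theorem: every `Ω_tc`-datum has exactly
  two vertices, while abc-iut-w5-d174's vertex growth (`PSCOriginVertexGrowth.lean`,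
  `not_restrictBDOfPSCTypeHolds_of_openInter`, fed with the exported F-0459
  `OpenInterDeterminesComponentHolds Ω_tc`) produces an open level with three or more vertices.

So the cusp-indexed Thm. 1.6 inputs hold at `Ω_tc` for the trivial reason, and `Ω_tc` is NOT an origin at
which the covering-closed Thm. 1.6 kernels (`thm16_holds_of_inputs`, `unrVerticialIff_holds_of_inputs'`) can
be run — their `hres` input fails there (consistent with abc-iut-w5-d174's R3).  0 definitions;
consistency / scope evidence at genuine multi-vertex data; not the printed theorems for all pointed stable
curves; nothing here takes a side on [IUTchIII] Cor. 3.12.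
-/

noncomputable section

namespace Literature.AnabelianGeometry.SemiGraphs

namespace PSCDatum

open scoped Pointwise
open Literature.GroupTheory.CombinatorialGroupTheory
open SemiGraphOfAnabelioids (IsProSigmaCompletion)

universe u

/-! ### Cusp-indexed rows at cusp-free origins -/

/-- **F-0458 / [CombGC] Thm. 1.6 (i) AS TYPED holds at every origin all of whose data have no cusps**:
for `G`, `H` without cusps every `α : Π_G ⥲ Π_H` is both numerically cuspidal (all cusp counts vanish)
and group-theoretically cuspidal (no cuspidal subgroups on either side).
[cite: MochizukiCombGC2007, Thm 1.6(i) p.13] -/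
theorem numericallyCuspidalIffHolds_of_isEmpty_cusps (Ω : PSCOrigin.{u})
    (hΩ : ∀ ⦃Q : Type u⦄ [Group Q] [TopologicalSpace Q] (G : PSCDatum Q), Ω.IsOfPSCType G →
      IsEmpty G.graph.C) :
    Literature.AnabelianGeometry.SemiGraphs.PSCDatum.NumericallyCuspidalIffHolds Ω := by
  intro Q _ _ _ Q' _ _ _ G H α hG hH
  haveI := hΩ G hG
  haveI := hΩ H hH
  exact G.numericallyCuspidalIff_of_isEmpty H α

/-- **F-1931 / [IUTchI] Rmk. 1.2.3 (iv), cuspidal part, AS TYPED holds at every origin all of whose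
data have no cusps**: no subgroup is cuspidal and none satisfies the ramification condition
(abc-iut-L3-t4's `cuspidalEdgeLikeCharacterization_of_isEmpty`).
[cite: Mochizuki2012, IUTchI Rmk 1.2.3(iv) pp.41-42] -/
theorem cuspidalEdgeLikeCharacterizationHolds_of_isEmpty_cusps (Ω : PSCOrigin.{u})
    (hΩ : ∀ ⦃Q : Type u⦄ [Group Q] [TopologicalSpace Q] (G : PSCDatum Q), Ω.IsOfPSCType G →
      IsEmpty G.graph.C) :
    Literature.AnabelianGeometry.SemiGraphs.PSCDatum.CuspidalEdgeLikeCharacterizationHolds Ω := by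
  intro Q _ _ _ G hG
  haveI := hΩ G hG
  exact G.cuspidalEdgeLikeCharacterization_of_isEmpty

/-! ### The two-component origin is not covering-closed -/

/-- **`¬ RestrictBDOfPSCTypeHolds Ω_tc`.**  Let `Ω` have the membership predicate of abc-iut-w4-d052's
`exists_twoComponentOrigin_rows` (`hiff`, displayed verbatim), its inhabitation clause (`hinh`) and
F-0459 `OpenInterDeterminesComponentHolds Ω` (exported there).  Every `Ω`-datum has at most two vertices
(`∀ w, w = v₀ ∨ w = v₁`), `Ω` has a member with two vertices on a profinite group, so abc-iut-w5-d174's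
vertex growth `not_restrictBDOfPSCTypeHolds_of_openInter` (bound `B = 2`) refutes covering-closure: some
finite étale covering of a two-component curve has at least three components.
[cite: MochizukiCombGC2007, Def 1.1(ii) p.6] -/
theorem not_restrictBDOfPSCTypeHolds_of_twoComponentOrigin (Ω : PSCOrigin.{0})
    (hiff : ∀ ⦃Q : Type⦄ [Group Q] [TopologicalSpace Q] (K : PSCDatum Q),
      Ω.IsOfPSCType K ↔
        ∃ (_ : IsTopologicalGroup Q), CompactSpace Q ∧ TotallyDisconnectedSpace Q ∧ IsEmpty K.graph.C ∧
          ∃ (g₁ g₂ : ℕ) (ι : PuncturedSurfaceGroup (g₁ + g₂) 0 →* Q) (v₀ v₁ : K.graph.V)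
            (e₀ : K.graph.N), 0 < g₁ ∧ 0 < g₂ ∧ IsProSigmaCompletion K.Sigma ι ∧ v₀ ≠ v₁ ∧
            (∀ w, w = v₀ ∨ w = v₁) ∧ (∀ e, e = e₀) ∧ K.graph.nodeEnds e₀ = s(v₀, v₁) ∧
            K.genus v₀ = g₁ ∧ K.genus v₁ = g₂ ∧
            K.vertGp v₀ = ((Subgroup.closure
              (Set.range (fun i : Fin g₁ => PuncturedSurfaceGroup.a (r := 0) (Fin.castAdd g₂ i)) ∪
                Set.range (fun i : Fin g₁ => PuncturedSurfaceGroup.b (r := 0) (Fin.castAdd g₂ i)))).map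
                  ι).topologicalClosure ∧
            K.vertGp v₁ = ((Subgroup.closure
              (Set.range (fun j : Fin g₂ => PuncturedSurfaceGroup.a (r := 0) (Fin.natAdd g₁ j)) ∪
                Set.range (fun j : Fin g₂ => PuncturedSurfaceGroup.b (r := 0) (Fin.natAdd g₁ j)))).map
                  ι).topologicalClosure ∧
            K.nodeGp e₀ = ((Subgroup.zpowers (List.ofFn fun i : Fin g₁ =>
              PuncturedSurfaceGroup.a (g := g₁ + g₂) (r := 0) (Fin.castAdd g₂ i) *
                PuncturedSurfaceGroup.b (Fin.castAdd g₂ i) *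
                  (PuncturedSurfaceGroup.a (Fin.castAdd g₂ i))⁻¹ *
                    (PuncturedSurfaceGroup.b (Fin.castAdd g₂ i))⁻¹).prod).map ι).topologicalClosure)
    (hinh : ∀ (S : Set ℕ), S.Nonempty → (∀ p ∈ S, p.Prime) → ∀ g₁ g₂ : ℕ, 0 < g₁ → 0 < g₂ →
      ∃ (Q : ProfiniteGrp.{0}) (G : PSCDatum Q), Ω.IsOfPSCType G ∧ G.Sigma = S ∧
        G.graph.i = 2 ∧ G.graph.n = 1 ∧ G.graph.r = 0 ∧
        (∃ v₀ v₁ : G.graph.V, v₀ ≠ v₁ ∧ G.genus v₀ = g₁ ∧ G.genus v₁ = g₂) ∧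
        (2 ≤ g₁ → 2 ≤ g₂ → G.IsSturdy))
    (hopen : OpenInterDeterminesComponentHolds Ω) :
    ¬ Literature.AnabelianGeometry.SemiGraphs.PSCDatum.RestrictBDOfPSCTypeHolds Ω := by
  -- every datum of `Ω` has at most two vertices
  have hB : ∀ ⦃Q : Type⦄ [Group Q] [TopologicalSpace Q] [IsTopologicalGroup Q] (K : PSCDatum Q),
      Ω.IsOfPSCType K → K.graph.i ≤ 2 := by
    intro Q _ _ _ K hK
    obtain ⟨_, -, -, -, g₁, g₂, ι, v₀, v₁, e₀, -, -, -, -, hV, -⟩ := (hiff K).mp hK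
    have h := Fintype.card_le_of_surjective (fun b : Bool => if b then v₁ else v₀) fun w =>
      (hV w).elim (fun h => ⟨false, by rw [h]; rfl⟩) fun h => ⟨true, by rw [h]; rfl⟩
    simpa only [Fintype.card_bool, PSCSemiGraph.i] using h
  -- a member with two vertices on a profinite group
  obtain ⟨Q, G, hG, -, hi, -⟩ :=
    hinh {2} ⟨2, Set.mem_singleton 2⟩ (fun p hp => by rw [Set.mem_singleton_iff.mp hp]; exact Nat.prime_two)
      1 1 one_pos one_pos
  exact G.not_restrictBDOfPSCTypeHolds_of_openInter Ω 2 hB hopen hG (le_of_eq hi.symm)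

/-- **The two-component origin: F-0458 ✓, F-1931 ✓ (no cusps), F-3808 ✗ (vertex growth)** — appended
to abc-iut-w4-d052's `exists_twoComponentOrigin_rows` at the SAME origin (membership predicate displayed
as an `↔`). [cite: MochizukiCombGC2007, Thm 1.6(i) p.13] -/
theorem exists_twoComponentOrigin_cuspFree_rows :
    ∃ Ω : PSCOrigin.{0},
      (∀ ⦃Q : Type⦄ [Group Q] [TopologicalSpace Q] (K : PSCDatum Q),
        Ω.IsOfPSCType K ↔
          ∃ (_ : IsTopologicalGroup Q), CompactSpace Q ∧ TotallyDisconnectedSpace Q ∧ IsEmpty K.graph.C ∧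
            ∃ (g₁ g₂ : ℕ) (ι : PuncturedSurfaceGroup (g₁ + g₂) 0 →* Q) (v₀ v₁ : K.graph.V)
              (e₀ : K.graph.N), 0 < g₁ ∧ 0 < g₂ ∧ IsProSigmaCompletion K.Sigma ι ∧ v₀ ≠ v₁ ∧
              (∀ w, w = v₀ ∨ w = v₁) ∧ (∀ e, e = e₀) ∧ K.graph.nodeEnds e₀ = s(v₀, v₁) ∧
              K.genus v₀ = g₁ ∧ K.genus v₁ = g₂ ∧
              K.vertGp v₀ = ((Subgroup.closure
                (Set.range (fun i : Fin g₁ => PuncturedSurfaceGroup.a (r := 0) (Fin.castAdd g₂ i)) ∪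
                  Set.range (fun i : Fin g₁ => PuncturedSurfaceGroup.b (r := 0) (Fin.castAdd g₂ i)))).map
                    ι).topologicalClosure ∧
              K.vertGp v₁ = ((Subgroup.closure
                (Set.range (fun j : Fin g₂ => PuncturedSurfaceGroup.a (r := 0) (Fin.natAdd g₁ j)) ∪
                  Set.range (fun j : Fin g₂ => PuncturedSurfaceGroup.b (r := 0) (Fin.natAdd g₁ j)))).map
                    ι).topologicalClosure ∧
              K.nodeGp e₀ = ((Subgroup.zpowers (List.ofFn fun i : Fin g₁ =>
                PuncturedSurfaceGroup.a (g := g₁ + g₂) (r := 0) (Fin.castAdd g₂ i) *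
                  PuncturedSurfaceGroup.b (Fin.castAdd g₂ i) *
                    (PuncturedSurfaceGroup.a (Fin.castAdd g₂ i))⁻¹ *
                      (PuncturedSurfaceGroup.b (Fin.castAdd g₂ i))⁻¹).prod).map ι).topologicalClosure) ∧
      Literature.AnabelianGeometry.SemiGraphs.PSCDatum.NumericallyCuspidalIffHolds Ω ∧
      Literature.AnabelianGeometry.SemiGraphs.PSCDatum.CuspidalEdgeLikeCharacterizationHolds Ω ∧
      ¬ Literature.AnabelianGeometry.SemiGraphs.PSCDatum.RestrictBDOfPSCTypeHolds Ω := by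
  obtain ⟨Ω, hiff, -, hinh, hopen, -⟩ := exists_twoComponentOrigin_rows
  have hC : ∀ ⦃Q : Type⦄ [Group Q] [TopologicalSpace Q] (G : PSCDatum Q), Ω.IsOfPSCType G →
      IsEmpty G.graph.C := fun Q _ _ G hG => by
    obtain ⟨_, -, -, hC, -⟩ := (hiff G).mp hG
    exact hC
  exact ⟨Ω, hiff, numericallyCuspidalIffHolds_of_isEmpty_cusps Ω hC,
    cuspidalEdgeLikeCharacterizationHolds_of_isEmpty_cusps Ω hC,
    not_restrictBDOfPSCTypeHolds_of_twoComponentOrigin Ω hiff hinh hopen⟩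

end PSCDatum

end Literature.AnabelianGeometry.SemiGraphs

end
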